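import Literature.NumberTheory.LFunctions.PrimeNumberTheoremQuasiRHIff
import Literature.NumberTheory.LFunctions.MertensPsiQuasiRHEquivalence
import HarnessLib

/-!
# Power-saving prime counts in ALL short intervals of length `N^{1−η/2}` ⟺ a zero-free half-plane for `ζ`
# (the two implications of the «prime-level transition» barrier, PROVED)

Cell landau-siegel, crux K_B (stmt-Parity-20343), planner memo `Cruxes/BeyondDiagonalBeatsQuarter/DECISION-MEMO-v4-RvsF.md`
§3 and its typed companion `Lines/rvsf_sketch.lean` §F (ls-Bfam-plan g9, f03e9de6a6470c4f): the funding hypothesis of the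
prime-level line's transition rows (TRANSITION-SIZING §9) is the short-interval input
`TransitionInputAt η ε N : ∀ x ∈ [N, 2N], |ψ(x + N^{1−η/2}) − ψ(x) − N^{1−η/2}| ≤ N^{1−η/2}·N^{−(η/2+ε)}`, and the memo
records it SANDWICHED between zero-free half-planes — both implications were left TYPED («the bookkeeping proof is left to a
prover seat»). This file proves them, with the hypotheses spelled out (no new definitions):

* `abs_psi_two_mul_sub_le_of_shortIntervals` — TELESCOPING over one block: if every window of length `w` with left end in
  `[N, 2N]` has `|ψ(x+w) − ψ(x) − w| ≤ w·δ` (`0 ≤ δ ≤ 1`), then `|ψ(2N) − ψ(N) − N| ≤ N·δ + 2w` — the one incomplete window is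
  handled by MONOTONICITY of `ψ` and the hypothesis at its left end (no Brun–Titchmarsh), which is why the abscissa below is
  `1 − η/2` and not `1 − η/2 − ε`;
* `abs_psi_sub_self_le_of_dyadic` — DYADIC summation: block bounds `|ψ(2N) − ψ(N) − N| ≤ A·N^α` for `N ≥ N₀ ≥ 1` give
  `|ψ(x) − x| ≤ (ψ(2N₀) + 2N₀) + (A/(2^α − 1))·x^α` for `x ≥ N₀`;
* **`quasiRiemannHypothesis_of_eventually_shortIntervals`** — the input at all large scales (`0 < η < 2`, `0 < ε`) gives
  `ψ(x) − x = O(x^{1−η/2})` (`isBigO_psi_sub_self_of_eventually_shortIntervals`) and hence, by the tree's PROVED converse of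
  von Koch's theorem `VonKochConverse.quasiRiemannHypothesis_of_isBigO` (Montgomery–Vaughan §15.1), **`QuasiRiemannHypothesis (1 − η/2)`**;
* **`eventually_shortIntervals_of_quasiRiemannHypothesis`** — conversely `QuasiRiemannHypothesis (1 − 2η)` (`0 < η < 1/4`)
  funds the input at every large scale with saving exponent `ε = η/4`, by the tree's PROVED
  `errorTerms_isBigO_of_quasiRiemannHypothesis` (`ψ(x) − x = O(x^{1−3η/2})`, Montgomery–Vaughan §13.1/§15.1).

So «power saving in all windows of length `N^{1−η/2}`» lies between quasi-RH(`1−2η`) and quasi-RH(`1−η/2`), each of which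
alone excludes every exceptional zero — the content of the barrier record `PrimeLevelTransitionZeroFreeBox`
(`Literature/Barriers/Parity/`, separate proposal). Theorems only; standard axioms.
«The programme SEARCHES and TYPES; no claim about Landau–Siegel zeros, Theorems 1–2 of arXiv:2211.02515 or
a repaired Margin232 until a kernel theorem says so.»

## References
* [MontgomeryVaughan2007] H. L. Montgomery, R. C. Vaughan, *Multiplicative Number Theory I*, CUP 2007, §13.1 (ψ under a
  zero-free half-plane), §15.1 (the converse) — derivation.
-/

noncomputable section

open Filter Asymptotics Finset
open scoped Chebyshev

namespace Literature.NumberTheory.LFunctions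

/-! ### One block: telescoping the windows -/

/-- **Telescoping over one block.** If every window of length `w > 0` with left end `x ∈ [N, 2N]` (`N ≥ 0`) satisfies
`|ψ(x+w) − ψ(x) − w| ≤ w·δ` with `0 ≤ δ ≤ 1`, then `|ψ(2N) − ψ(N) − N| ≤ N·δ + 2w`: `⌊N/w⌋` full windows contribute
`≤ N·δ`, and the incomplete last window `[N + ⌊N/w⌋w, 2N]` contributes `≤ 2w` by monotonicity of `ψ` and the hypothesis at
its left end. [cite: MontgomeryVaughan2007, §15.1 — derivation] -/
theorem abs_psi_two_mul_sub_le_of_shortIntervals {N w δ : ℝ} (hN : 0 ≤ N) (hw : 0 < w) (hδ : 0 ≤ δ) (hδ1 : δ ≤ 1)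
    (h : ∀ x : ℝ, N ≤ x → x ≤ 2 * N → |ψ (x + w) - ψ x - w| ≤ w * δ) :
    |ψ (2 * N) - ψ N - N| ≤ N * δ + 2 * w := by
  set K : ℕ := ⌊N / w⌋₊ with hK
  have hKle : (K : ℝ) ≤ N / w := Nat.floor_le (div_nonneg hN hw.le)
  have hKw : (K : ℝ) * w ≤ N := by
    calc (K : ℝ) * w ≤ N / w * w := mul_le_mul_of_nonneg_right hKle hw.le
      _ = N := div_mul_cancel₀ N hw.ne'
  have hNKw : N - K * w < w := by
    have h1 : N / w < (K : ℝ) + 1 := Nat.lt_floor_add_one _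
    have h2 : N < ((K : ℝ) + 1) * w := (div_lt_iff₀ hw).1 h1
    linarith
  -- the grid points `N + k w`, `k ≤ K`, lie in `[N, 2N]`
  have hx : ∀ k : ℕ, k ≤ K → N ≤ N + k * w ∧ N + k * w ≤ 2 * N := by
    intro k hk
    have hk' : (k : ℝ) * w ≤ K * w := mul_le_mul_of_nonneg_right (by exact_mod_cast hk) hw.le
    exact ⟨le_add_of_nonneg_right (by positivity), by linarith⟩
  -- the full windows
  have htel : ∑ k ∈ Finset.range K, (ψ (N + ((k + 1 : ℕ) : ℝ) * w) - ψ (N + k * w) - w) =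
      ψ (N + K * w) - ψ N - K * w := by
    rw [Finset.sum_sub_distrib, Finset.sum_range_sub (fun k : ℕ ↦ ψ (N + (k : ℝ) * w)) K, Finset.sum_const,
      Finset.card_range, nsmul_eq_mul]
    simp
  have hfull : |ψ (N + K * w) - ψ N - K * w| ≤ N * δ := by
    rw [← htel]
    calc |∑ k ∈ Finset.range K, (ψ (N + ((k + 1 : ℕ) : ℝ) * w) - ψ (N + k * w) - w)|
        ≤ ∑ k ∈ Finset.range K, |ψ (N + ((k + 1 : ℕ) : ℝ) * w) - ψ (N + k * w) - w| :=
          Finset.abs_sum_le_sum_abs _ _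
      _ ≤ ∑ _k ∈ Finset.range K, w * δ := by
          refine Finset.sum_le_sum fun k hk ↦ ?_
          have hk : k < K := Finset.mem_range.1 hk
          have hwin := h (N + k * w) (hx k hk.le).1 (hx k hk.le).2
          have heq : N + ((k + 1 : ℕ) : ℝ) * w = N + k * w + w := by push_cast; ring
          rwa [heq]
      _ = K * (w * δ) := by rw [Finset.sum_const, Finset.card_range, nsmul_eq_mul]
      _ ≤ N / w * (w * δ) := mul_le_mul_of_nonneg_right hKle (by positivity)
      _ = N * δ := by field_simp
  -- the incomplete window
  have hpart : |ψ (2 * N) - ψ (N + K * w) - (N - K * w)| ≤ 2 * w := by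
    have hmono1 : ψ (N + K * w) ≤ ψ (2 * N) := Chebyshev.psi_mono (by linarith)
    have hmono2 : ψ (2 * N) ≤ ψ (N + K * w + w) := Chebyshev.psi_mono (by linarith)
    have hwin := h (N + K * w) (hx K le_rfl).1 (hx K le_rfl).2
    have h1 : ψ (N + K * w + w) - ψ (N + K * w) ≤ w + w * δ := by linarith [(abs_le.1 hwin).2]
    have hwδ : w * δ ≤ w := by nlinarith
    rw [abs_le]
    constructor <;> nlinarith
  have hsplit : ψ (2 * N) - ψ N - N =
      (ψ (N + K * w) - ψ N - K * w) + (ψ (2 * N) - ψ (N + K * w) - (N - K * w)) := by ring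
  rw [hsplit]
  exact (abs_add_le _ _).trans (add_le_add hfull hpart)

/-- The block estimate in the barrier's parametrisation: if at scale `N ≥ 1` every window of length `N^{1−η/2}` with left
end in `[N, 2N]` has `|ψ(x + N^{1−η/2}) − ψ(x) − N^{1−η/2}| ≤ N^{1−η/2}·N^{−(η/2+ε)}` (`0 < η`, `0 ≤ ε`), then
`|ψ(2N) − ψ(N) − N| ≤ 3·N^{1−η/2}`. [cite: MontgomeryVaughan2007, §15.1 — derivation] -/
theorem abs_psi_two_mul_sub_le_rpow {η ε N : ℝ} (hη : 0 < η) (hε : 0 ≤ ε) (hN : 1 ≤ N)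
    (h : ∀ x : ℝ, N ≤ x → x ≤ 2 * N →
      |ψ (x + N ^ (1 - η / 2)) - ψ x - N ^ (1 - η / 2)| ≤ N ^ (1 - η / 2) * N ^ (-(η / 2 + ε))) :
    |ψ (2 * N) - ψ N - N| ≤ 3 * N ^ (1 - η / 2) := by
  have hN0 : 0 < N := by linarith
  have hw : 0 < N ^ (1 - η / 2) := Real.rpow_pos_of_pos hN0 _
  have hδ0 : 0 ≤ N ^ (-(η / 2 + ε)) := Real.rpow_nonneg hN0.le _
  have hδ1 : N ^ (-(η / 2 + ε)) ≤ 1 := Real.rpow_le_one_of_one_le_of_nonpos hN (by linarith)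
  have hmain := abs_psi_two_mul_sub_le_of_shortIntervals hN0.le hw hδ0 hδ1 h
  have h1 : N * N ^ (-(η / 2 + ε)) ≤ N ^ (1 - η / 2) := by
    calc N * N ^ (-(η / 2 + ε)) = N ^ ((1 : ℝ) + (-(η / 2 + ε))) := by
          rw [Real.rpow_add hN0, Real.rpow_one]
      _ ≤ N ^ (1 - η / 2) := Real.rpow_le_rpow_of_exponent_le hN (by linarith)
  linarith

/-! ### Dyadic summation -/

/-- **Dyadic summation of block bounds.** If `|ψ(2N) − ψ(N) − N| ≤ A·N^α` for all `N ≥ N₀` (`N₀ ≥ 1`, `α > 0`, `A ≥ 0`), then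
for all `x ≥ N₀`: `|ψ(x) − x| ≤ (ψ(2N₀) + 2N₀) + (A/(2^α − 1))·x^α` (induction over the dyadic scale of `x/N₀`; the constant
`B = A/(2^α − 1)` is the fixed point of `B ↦ (B + A)·2^{−α}`). [cite: MontgomeryVaughan2007, §15.1 — derivation] -/
theorem abs_psi_sub_self_le_of_dyadic {N₀ α A : ℝ} (hN₀ : 1 ≤ N₀) (hα : 0 < α) (hA : 0 ≤ A)
    (hblock : ∀ N : ℝ, N₀ ≤ N → |ψ (2 * N) - ψ N - N| ≤ A * N ^ α) :
    ∀ x : ℝ, N₀ ≤ x → |ψ x - x| ≤ (ψ (2 * N₀) + 2 * N₀) + A / ((2 : ℝ) ^ α - 1) * x ^ α := by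
  set C₀ : ℝ := ψ (2 * N₀) + 2 * N₀ with hC₀
  set B : ℝ := A / ((2 : ℝ) ^ α - 1) with hB
  have h2α : 1 < (2 : ℝ) ^ α := Real.one_lt_rpow one_lt_two hα
  have hB0 : 0 ≤ B := div_nonneg hA (by linarith)
  have hne : (2 : ℝ) ^ α - 1 ≠ 0 := ne_of_gt (by linarith)
  have hBfix : (B + A) / (2 : ℝ) ^ α = B := by
    have h2 : (0 : ℝ) < (2 : ℝ) ^ α := by positivity
    rw [div_eq_iff h2.ne', hB]
    field_simp
    ring
  -- induction over the dyadic scale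
  have key : ∀ n : ℕ, ∀ x : ℝ, N₀ * 2 ^ n ≤ x → x < N₀ * 2 ^ (n + 1) → |ψ x - x| ≤ C₀ + B * x ^ α := by
    intro n
    induction n with
    | zero =>
      intro x hx1 hx2
      simp only [pow_zero, mul_one, zero_add, pow_one] at hx1 hx2
      have hx0 : 0 ≤ x := by linarith
      have hψ : ψ x ≤ ψ (2 * N₀) := Chebyshev.psi_mono (by linarith)
      have hψ0 : 0 ≤ ψ x := Chebyshev.psi_nonneg x
      have hBx : 0 ≤ B * x ^ α := mul_nonneg hB0 (Real.rpow_nonneg hx0 _)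
      rw [abs_le]
      constructor <;> linarith
    | succ n ih =>
      intro x hx1 hx2
      have hpow : (1 : ℝ) ≤ 2 ^ n := one_le_pow₀ (by norm_num)
      have hx0 : 0 < x := by
        have : 0 < N₀ * 2 ^ (n + 1) := by positivity
        linarith
      -- `x/2` is one dyadic scale down and `≥ N₀`
      have hy1 : N₀ * 2 ^ n ≤ x / 2 := by
        rw [le_div_iff₀ (by norm_num : (0 : ℝ) < 2), pow_succ] at *
        linarith
      have hy2 : x / 2 < N₀ * 2 ^ (n + 1) := by
        rw [div_lt_iff₀ (by norm_num : (0 : ℝ) < 2)]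
        calc x < N₀ * 2 ^ (n + 1 + 1) := hx2
          _ = N₀ * 2 ^ (n + 1) * 2 := by ring
      have hyN₀ : N₀ ≤ x / 2 := le_trans (by nlinarith) hy1
      have hih := ih (x / 2) hy1 hy2
      have hbl := hblock (x / 2) hyN₀
      rw [show 2 * (x / 2) = x by ring] at hbl
      have hhalf : (x / 2) ^ α = x ^ α / (2 : ℝ) ^ α := Real.div_rpow hx0.le (by norm_num) α
      have hsplit : ψ x - x = (ψ (x / 2) - x / 2) + (ψ x - ψ (x / 2) - x / 2) := by ring
      rw [hsplit]
      calc |ψ (x / 2) - x / 2 + (ψ x - ψ (x / 2) - x / 2)|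
          ≤ |ψ (x / 2) - x / 2| + |ψ x - ψ (x / 2) - x / 2| := abs_add_le _ _
        _ ≤ (C₀ + B * (x / 2) ^ α) + A * (x / 2) ^ α := add_le_add hih hbl
        _ = C₀ + (B + A) / (2 : ℝ) ^ α * x ^ α := by rw [hhalf]; ring
        _ = C₀ + B * x ^ α := by rw [hBfix]
  intro x hx
  have hx0 : 0 < x := by linarith
  obtain ⟨n, hn1, hn2⟩ := exists_nat_pow_near (show 1 ≤ x / N₀ from (one_le_div (by linarith)).2 hx) one_lt_two
  refine key n x ?_ ?_
  · have := (le_div_iff₀ (by linarith : (0 : ℝ) < N₀)).1 hn1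
    linarith [this]
  · have := (div_lt_iff₀ (by linarith : (0 : ℝ) < N₀)).1 hn2
    linarith [this]

/-! ### From the input at all large scales to a zero-free half-plane -/

/-- **Short-interval power saving for all large scales ⇒ `ψ(x) − x = O(x^{1−η/2})`.** (`0 < η`, `0 ≤ ε`.)
[cite: MontgomeryVaughan2007, §15.1 — derivation] -/
theorem isBigO_psi_sub_self_of_eventually_shortIntervals {η ε : ℝ} (hη0 : 0 < η) (hη2 : η < 2) (hε : 0 ≤ ε)
    (h : ∀ᶠ N : ℝ in atTop, ∀ x : ℝ, N ≤ x → x ≤ 2 * N →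
      |ψ (x + N ^ (1 - η / 2)) - ψ x - N ^ (1 - η / 2)| ≤ N ^ (1 - η / 2) * N ^ (-(η / 2 + ε))) :
    (fun x ↦ ψ x - x) =O[atTop] fun x : ℝ ↦ x ^ (1 - η / 2) := by
  obtain ⟨N₁, hN₁⟩ := eventually_atTop.1 h
  set N₀ : ℝ := max N₁ 1 with hN₀def
  have hN₀1 : 1 ≤ N₀ := le_max_right _ _
  have hα : 0 < 1 - η / 2 := by linarith
  have hblock : ∀ N : ℝ, N₀ ≤ N → |ψ (2 * N) - ψ N - N| ≤ 3 * N ^ (1 - η / 2) := fun N hN ↦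
    abs_psi_two_mul_sub_le_rpow hη0 hε (le_trans hN₀1 hN) (hN₁ N (le_trans (le_max_left _ _) hN))
  have hbound := abs_psi_sub_self_le_of_dyadic hN₀1 hα (by norm_num : (0 : ℝ) ≤ 3) hblock
  set C₀ : ℝ := ψ (2 * N₀) + 2 * N₀
  set B : ℝ := 3 / ((2 : ℝ) ^ (1 - η / 2) - 1)
  have hC₀ : 0 ≤ C₀ := by have := Chebyshev.psi_nonneg (2 * N₀); positivity
  refine IsBigO.of_bound (C₀ + B) (eventually_atTop.2 ⟨N₀, fun x hx ↦ ?_⟩)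
  have hx1 : 1 ≤ x := le_trans hN₀1 hx
  have hxα : 1 ≤ x ^ (1 - η / 2) := Real.one_le_rpow hx1 hα.le
  have hxα0 : 0 ≤ x ^ (1 - η / 2) := by linarith
  rw [Real.norm_eq_abs, Real.norm_eq_abs, abs_of_nonneg hxα0]
  calc |ψ x - x| ≤ C₀ + B * x ^ (1 - η / 2) := hbound x hx
    _ ≤ C₀ * x ^ (1 - η / 2) + B * x ^ (1 - η / 2) := by nlinarith
    _ = (C₀ + B) * x ^ (1 - η / 2) := by ring

/-- **Power-saving prime counts in all windows of length `N^{1−η/2}`, for all large scales, force a zero-free half-plane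
`re s > 1 − η/2` for `ζ`** (`0 < η < 2`, `0 ≤ ε`): the converse of von Koch's theorem (tree, PROVED:
`VonKochConverse.quasiRiemannHypothesis_of_isBigO`) applied to `isBigO_psi_sub_self_of_eventually_shortIntervals`. This is
the «because» direction of the barrier `PrimeLevelTransitionZeroFreeBox`: the transition input of the prime-level line
(TRANSITION-SIZING §9) is at least of quasi-RH strength. [cite: MontgomeryVaughan2007, §15.1 — derivation] -/
theorem quasiRiemannHypothesis_of_eventually_shortIntervals {η ε : ℝ} (hη0 : 0 < η) (hη2 : η < 2) (hε : 0 ≤ ε)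
    (h : ∀ᶠ N : ℝ in atTop, ∀ x : ℝ, N ≤ x → x ≤ 2 * N →
      |ψ (x + N ^ (1 - η / 2)) - ψ x - N ^ (1 - η / 2)| ≤ N ^ (1 - η / 2) * N ^ (-(η / 2 + ε))) :
    QuasiRiemannHypothesis (1 - η / 2) :=
  VonKochConverse.quasiRiemannHypothesis_of_isBigO (by linarith)
    (isBigO_psi_sub_self_of_eventually_shortIntervals hη0 hη2 hε h)

/-! ### From a zero-free half-plane to the input at all large scales -/

/-- **A zero-free half-plane `re s > 1 − 2η` funds the transition input at every large scale, with saving exponent `η/4`**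
(`0 < η < 1/4`): `ψ(x) − x = O(x^{1−3η/2})` (tree, PROVED: `errorTerms_isBigO_of_quasiRiemannHypothesis` at `Θ = 1 − 2η`,
`ε = η/2`), so `|ψ(x+w) − ψ(x) − w| ≤ 2C(3N)^{1−3η/2} ≤ w·N^{−3η/4}` for `x ∈ [N, 2N]`, `w = N^{1−η/2}`, once
`2C·3^{1−3η/2} ≤ N^{η/4}`. The «funding» direction of the barrier record (safe abscissa; the analyst's sharper zero-free
BOX of TRANSITION-SIZING §9 is not claimed). [cite: MontgomeryVaughan2007, §13.1 and §15.1 — derivation] -/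
theorem eventually_shortIntervals_of_quasiRiemannHypothesis {η : ℝ} (hη0 : 0 < η) (hη : η < 1 / 4)
    (hQ : QuasiRiemannHypothesis (1 - 2 * η)) :
    ∀ᶠ N : ℝ in atTop, ∀ x : ℝ, N ≤ x → x ≤ 2 * N →
      |ψ (x + N ^ (1 - η / 2)) - ψ x - N ^ (1 - η / 2)| ≤ N ^ (1 - η / 2) * N ^ (-(η / 2 + η / 4)) := by
  set β : ℝ := 1 - 2 * η + η / 2 with hβ
  have hβ0 : 0 < β := by rw [hβ]; linarith
  have hO : (fun x ↦ ψ x - x) =O[atTop] fun x : ℝ ↦ x ^ β :=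
    (errorTerms_isBigO_of_quasiRiemannHypothesis hQ (by linarith) (by linarith) (by linarith : 0 < η / 2)).2.1
  obtain ⟨C, hC0, hCO⟩ := hO.exists_nonneg
  obtain ⟨X₀, hX₀⟩ := eventually_atTop.1 hCO.bound
  -- the three eventualities in the scale
  have e1 : ∀ᶠ N : ℝ in atTop, X₀ ≤ N := eventually_ge_atTop X₀
  have e2 : ∀ᶠ N : ℝ in atTop, (1 : ℝ) ≤ N := eventually_ge_atTop 1
  have e3 : ∀ᶠ N : ℝ in atTop, 2 * C * (3 : ℝ) ^ β ≤ N ^ (η / 4) :=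
    (tendsto_rpow_atTop (by linarith : 0 < η / 4)).eventually_ge_atTop _
  filter_upwards [e1, e2, e3] with N hN1 hN2 hN3
  intro x hx1 hx2
  have hN0 : 0 < N := by linarith
  set w : ℝ := N ^ (1 - η / 2) with hw
  have hw0 : 0 < w := Real.rpow_pos_of_pos hN0 _
  have hwN : w ≤ N := by
    calc w = N ^ (1 - η / 2) := rfl
      _ ≤ N ^ (1 : ℝ) := Real.rpow_le_rpow_of_exponent_le hN2 (by linarith)
      _ = N := Real.rpow_one N
  have hx0 : 0 < x := by linarith
  -- pointwise bounds from the `O`-estimate at `x` and `x + w`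
  have hψ : ∀ y : ℝ, X₀ ≤ y → 0 < y → |ψ y - y| ≤ C * y ^ β := by
    intro y hy hy0
    have := hX₀ y hy
    rwa [Real.norm_eq_abs, Real.norm_eq_abs, abs_of_nonneg (Real.rpow_nonneg hy0.le _)] at this
  have hb1 := hψ x (by linarith) hx0
  have hb2 := hψ (x + w) (by linarith) (by linarith)
  -- `y^β ≤ (3N)^β` on `[N, 3N]`
  have h3N : ∀ y : ℝ, 0 ≤ y → y ≤ 3 * N → y ^ β ≤ (3 : ℝ) ^ β * N ^ β := by
    intro y hy0 hy
    rw [← Real.mul_rpow (by norm_num) hN0.le]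
    exact Real.rpow_le_rpow hy0 hy hβ0.le
  have hb1' := h3N x hx0.le (by linarith)
  have hb2' := h3N (x + w) (by linarith) (by linarith)
  -- the target exponent: `w · N^{−3η/4} = N^{β + η/4}`
  have htarget : w * N ^ (-(η / 2 + η / 4)) = N ^ β * N ^ (η / 4) := by
    rw [hw, ← Real.rpow_add hN0, ← Real.rpow_add hN0, hβ]
    ring_nf
  have hdiff : ψ (x + w) - ψ x - w = (ψ (x + w) - (x + w)) - (ψ x - x) := by ring
  rw [hdiff, htarget]
  calc |ψ (x + w) - (x + w) - (ψ x - x)|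
      ≤ |ψ (x + w) - (x + w)| + |ψ x - x| := abs_sub _ _
    _ ≤ C * (x + w) ^ β + C * x ^ β := add_le_add hb2 hb1
    _ ≤ C * ((3 : ℝ) ^ β * N ^ β) + C * ((3 : ℝ) ^ β * N ^ β) := by gcongr
    _ = (2 * C * (3 : ℝ) ^ β) * N ^ β := by ring
    _ ≤ N ^ (η / 4) * N ^ β := mul_le_mul_of_nonneg_right hN3 (Real.rpow_nonneg hN0.le _)
    _ = N ^ β * N ^ (η / 4) := mul_comm _ _

end Literature.NumberTheory.LFunctions
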